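import Summits.QuantumFields.BalabanUV.Beta.FP.NestedStepLawTorusInstance
import Summits.QuantumFields.BalabanUV.Beta.FP.RelInvPeriodisedEffFormCoarse

/-!
# `BalabanUV.Beta.FP.NestedStepLawTorusInstanceDelta` — road «FP» for binder row D1, ROUTE T, (T-INST-j): THE TORUS CALL (p313662) SPECIALISED TO THE δ-CONSTRAINED
# COMPOSITE OF RECORD (`G = 0`, `𝔎 = H`; `Q₂₀ :=` the level-`(j+1)` one-step rows) WITH THE ORDER-0 COARSE COVARIANCE `d0` DISCHARGED

WHY.  leaf-05 g25 (`RelInvPeriodisedEffFormCoarse`, INTENT 18): «the `U = 1` composite is δ-constrained: no block weight»; with `G₀ = 0` the coarse sliced system of p308750 is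
`kkt (effForm H₀ [Q₁₀;τ₁])₁₁ [Q₂₀; τ₂]` and its non-degeneracy `h2` IS leaf-05's `torus_h2_record` (p314974) — DISCHARGED here;
`d0 : Q₂₀·D̄ = 0` is gan24-leaf-05's (C1) (`TorusGaugeCovariance.perF_bhKStepAt_mul_tgrad_of_not_root`, p308208) ONE LEVEL UP times the displayed `stepScale·#B` factor.
What stays displayed: the jets `H₁ H₂ Q₁₁ Q₁₂ Q₂₁ Q₂₂`, the generator jets `W₁ W₂ D̄₁ D̄₂`, the Ward ∕ covariance TABLE IDENTITIES `a* c1 c2 d1 d2` (moving shapes; leaf-02's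
`PeriodisedBorderWardContactInstance` p314580 discharges `c1` for single-bond and weighted insertions), the namings, the coarse-coarse presentation letters; the FP
defect in the conclusion.  NINE binders of p308750 are now discharged at the torus: `h1 c0 hTW hPW b0 b1 b2 d0 h2`.

HONEST DEPENDENCY (page 1, mandatory): continuum YM on T⁴ ⇐ BetaPertH ∧ nine spine estimates (0/9 proved); BetaPertH ⇐ (D1) ∧ (D4) ∧ CAP+tail;
G-an2-4 gates asym, D1 and NE2/3/4.  HONEST FRAMING (cell contract, verbatim): «discharging `BetaPertH` makes Bałaban's UV stability UNCONDITIONAL —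
a real constructive-QFT result; it is NOT the continuum limit and NOT the Clay problem.»  ABSOLUTE RULE (cell charter, verbatim): «No internally-minted
statement may enter as a cited fact. Every hypothesis is either kernel-proved in this package or a verbatim quotation of a PUBLISHED theorem with page
reference. The manuscript(s) under audit are NOT citable for their own disputed steps — they are the thing under adjudication; programme-internal
(2001/route/tribunal) claims are never citable.»  [folklore] composition BY NAME; no `def`, no `def … : Prop`, nothing cited, 0 sorry; 0∕4 row-D1 binders;
NOT (T-ID) complete, NOT SDF, NOT D1, NOT BetaPertH, NOT continuum, NOT Clay.  Road «FP» OWNER, b2b-balaban-beta-d1-p3 gen 17, 2026-08-22.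
-/

noncomputable section

namespace Summit.QuantumFields.BalabanUV.Beta.FP.NestedStepLawTorusInstanceDelta

open Matrix Finset
open Literature.Probability.LatticeModels (Torus.proj)
open Literature.MathematicalPhysics.QuantumFieldTheory.Balaban1983to89
open Literature.MathematicalPhysics.QuantumFieldTheory.Balaban1983to89.Beta
open Literature.MathematicalPhysics.QuantumFieldTheory.Balaban1983to89.Beta.Composition (kkt)
open Literature.MathematicalPhysics.QuantumFieldTheory.Balaban1983to89.Beta.CompositionSingular (effForm flucCov minOp minOpL)
open B5Prop11Plancherel (fine)
open B6Lemma24Torus (pbox mem_pbox)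
open AffineAveraging (Site box toSite)
open OneStepResolventKernel (Fib)
open Summit.QuantumFields.BalabanUV.Beta.BorderedHessian (bhKStepAt stepScale)
open Summit.QuantumFields.BalabanUV.Beta.D1BFx.LogDetSecondVariation (secondVar)
open Summit.QuantumFields.BalabanUV.Beta.FP.KernelPeriodisationFib (Idx perF)
open Summit.QuantumFields.BalabanUV.Beta.FP.TorusGaugeCovariance (tgrad tgrad_inr sum_mul_tgrad_eq_sum_inl perF_bhKStepAt_mul_tgrad_of_not_root)
open Summit.QuantumFields.BalabanUV.Beta.FP.TorusGaugeCovarianceCoarse (coarsePt tgradBlock)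
open Summit.QuantumFields.BalabanUV.Beta.FP.TorusCombRows (Res combRowsT ne_rootOf_iff_proj_ne)
open Summit.QuantumFields.BalabanUV.Beta.FP.TorusCombNestedBasis (resBigEquiv)
open Summit.QuantumFields.BalabanUV.Beta.FP.TorusGaugeCovarianceCoarse (coarsePt_coe)
open Summit.QuantumFields.BalabanUV.Beta.FP.NestedStepLawTorusInstance (submatrix_field_mul coarseSlot_injective coarseSlot_range
  secondVar_oneShot_nestedStepLaw_torus)
open Summit.QuantumFields.BalabanUV.Beta.FP.RelInvPeriodisedEffFormCoarse (torus_h2_record)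
open Summit.QuantumFields.BalabanUV.Beta.GAN24.FineReadoutCauchyFrame (toSite_mem_range)

variable {d : ℕ}

section Delta

variable (M' : Fin (d + 1) → ℕ) [∀ μ, NeZero (M' μ)] {Lc : ℕ} [NeZero Lc] {r r' : Fin (d + 1) → ℕ}

/-- [folklore] **`d0 : Q₂₀·D̄ = 0` AT THE TORUS** (gan24-leaf-05's (C1) on the coarse box at any level `k`, times the `D̄` scalar): the one-step averaging rows of the
coarse box, read at any multiplier rows `(pμ′ a, inr (mμ′ a))`, kill the residual coarse torus gradients. -/
theorem torus_cov₀' (hr' : r' ∈ box (d + 1) Lc) (hM' : ∀ i, Lc ∣ M' i) (j k : ℕ) {κ : Type*} (pμ' : κ → ↥(pbox M')) (mμ' : κ → Fin (d + 1)) :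
    (perF M' (bhKStepAt d (toSite r') Lc k)).submatrix (fun a : κ => ((pμ' a, Sum.inr (mμ' a)) : Idx M' (Fib d)))
          (fun b : ↥(pbox M') × Fin (d + 1) => ((b.1, Sum.inl b.2) : Idx M' (Fib d)))
        * Matrix.of (fun (a : ↥(pbox M') × Fin (d + 1)) (t : Res (toSite r') Lc M') =>
            stepScale d Lc j * (((box (d + 1) Lc).card : ℝ) * tgrad M' (a.1, Sum.inl a.2) t.1)) = 0 := by
  ext a t
  rw [Matrix.zero_apply, Matrix.mul_apply]
  have hC := perF_bhKStepAt_mul_tgrad_of_not_root M' hr' hM' k (pμ' a) (mμ' a)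
    ((ne_rootOf_iff_proj_ne (Nat.pos_of_ne_zero (NeZero.ne Lc)) (toSite_mem_range hr') _).1 t.2)
  rw [sum_mul_tgrad_eq_sum_inl, ← Fintype.sum_prod_type'] at hC
  rw [Finset.sum_congr rfl fun (b : ↥(pbox M') × Fin (d + 1)) _ =>
      show (perF M' (bhKStepAt d (toSite r') Lc k)).submatrix (fun a : κ => ((pμ' a, Sum.inr (mμ' a)) : Idx M' (Fib d)))
            (fun b : ↥(pbox M') × Fin (d + 1) => ((b.1, Sum.inl b.2) : Idx M' (Fib d))) a b
          * Matrix.of (fun (a : ↥(pbox M') × Fin (d + 1)) (t : Res (toSite r') Lc M') =>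
              stepScale d Lc j * (((box (d + 1) Lc).card : ℝ) * tgrad M' (a.1, Sum.inl a.2) t.1)) b t
        = perF M' (bhKStepAt d (toSite r') Lc k) (pμ' a, Sum.inr (mμ' a)) (b.1, Sum.inl b.2) * tgrad M' (b.1, Sum.inl b.2) t.1
          * (stepScale d Lc j * ((box (d + 1) Lc).card : ℝ)) by
        rw [Matrix.submatrix_apply, Matrix.of_apply]; ring,
    ← Finset.sum_mul, hC, zero_mul]

set_option synthInstance.maxSize 1024 in
/-- [folklore] **THE TORUS CALL, δ-CONSTRAINED COMPOSITE** (the `U = 1` composite has no block weight: `G₀ = G₁ = G₂ = 0`, `𝔎 = H` — leaf-05 g25's reading;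
`Q₂₀ :=` the level-`(j+1)` one-step averaging rows on the coarse box, presented on any coarse-coarse multiplier index `κ` by `a ↦ (pμ′ a, inr (mμ′ a))`):
`NestedStepLawTorusInstance.secondVar_oneShot_nestedStepLaw_torus` with these specialisations, the order-0 coarse covariance `d0 : Q₂₀·D̄ = 0` DISCHARGED (gan24-leaf-05's
(C1) one level up, `torus_cov₀'`) AND the coarse non-degeneracy `h2` DISCHARGED by leaf-05's `RelInvPeriodisedEffFormCoarse.torus_h2_record` (the `G = 0` system;
the coarse-coarse presentation letters `hfμ′ hcoarse′` displayed). -/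
theorem secondVar_oneShot_nestedStepLaw_torus_delta (hr : r ∈ box (d + 1) Lc) (hr' : r' ∈ box (d + 1) Lc) (hM' : ∀ i, Lc ∣ M' i) (j : ℕ)
    {κ : Type*} [Fintype κ] [DecidableEq κ] (pμ' : κ → ↥(pbox M')) (mμ' : κ → Fin (d + 1))
    (hfμ' : Function.Injective (fun a : κ => ((pμ' a, Sum.inr (mμ' a)) : Idx M' (Fib d))))
    (hcoarse' : ∀ (s : ↥(pbox M')) (m : Fin (d + 1)),
      ((s, Sum.inr m) : Idx M' (Fib d)) ∈ Set.range (fun a : κ => ((pμ' a, Sum.inr (mμ' a)) : Idx M' (Fib d))) ↔ Torus.proj Lc (s : Site (d + 1)) = 0)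
    -- the torus objects of record, by defining equations
    {H₀ : Matrix (↥(pbox (fine Lc M')) × Fin (d + 1)) (↥(pbox (fine Lc M')) × Fin (d + 1)) ℝ}
    {Q₁₀ : Matrix (↥(pbox M') × Fin (d + 1)) (↥(pbox (fine Lc M')) × Fin (d + 1)) ℝ}
    {τ₁ : Matrix (Res (toSite r) Lc (fine Lc M')) (↥(pbox (fine Lc M')) × Fin (d + 1)) ℝ}
    {τ₂ : Matrix (Res (toSite r') Lc M') (↥(pbox M') × Fin (d + 1)) ℝ}
    {D₁ : Matrix (↥(pbox (fine Lc M')) × Fin (d + 1)) (Res (toSite r) Lc (fine Lc M')) ℝ}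
    {D₂ : Matrix (↥(pbox (fine Lc M')) × Fin (d + 1)) (Res (toSite r') Lc M') ℝ}
    {Dbar : Matrix (↥(pbox M') × Fin (d + 1)) (Res (toSite r') Lc M') ℝ}
    {P : Matrix (Res (toSite r') Lc M' ⊕ Res (toSite r) Lc (fine Lc M')) (↥(pbox (fine Lc M')) × Fin (d + 1)) ℝ}
    (hH₀ : H₀ = (perF (fine Lc M') (bhKStepAt d (toSite r) Lc j)).submatrix
        (fun b : ↥(pbox (fine Lc M')) × Fin (d + 1) => ((b.1, Sum.inl b.2) : Idx (fine Lc M') (Fib d)))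
        (fun b : ↥(pbox (fine Lc M')) × Fin (d + 1) => ((b.1, Sum.inl b.2) : Idx (fine Lc M') (Fib d))))
    (hQ₁₀ : Q₁₀ = (perF (fine Lc M') (bhKStepAt d (toSite r) Lc j)).submatrix
        (fun a : ↥(pbox M') × Fin (d + 1) => ((coarsePt M' Lc a.1, Sum.inr a.2) : Idx (fine Lc M') (Fib d)))
        (fun b : ↥(pbox (fine Lc M')) × Fin (d + 1) => ((b.1, Sum.inl b.2) : Idx (fine Lc M') (Fib d))))
    (hτ₁ : τ₁ = (combRowsT (toSite r) Lc (fine Lc M')).submatrix id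
        (fun b : ↥(pbox (fine Lc M')) × Fin (d + 1) => ((b.1, Sum.inl b.2) : Idx (fine Lc M') (Fib d))))
    (hτ₂ : τ₂ = (combRowsT (toSite r') Lc M').submatrix id (fun b : ↥(pbox M') × Fin (d + 1) => ((b.1, Sum.inl b.2) : Idx M' (Fib d))))
    (hD₁ : D₁ = (tgrad (fine Lc M')).submatrix (fun b : ↥(pbox (fine Lc M')) × Fin (d + 1) => ((b.1, Sum.inl b.2) : Idx (fine Lc M') (Fib d)))
        (Subtype.val : Res (toSite r) Lc (fine Lc M') → ↥(pbox (fine Lc M'))))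
    (hD₂ : D₂ = (tgradBlock M' Lc).submatrix (fun b : ↥(pbox (fine Lc M')) × Fin (d + 1) => ((b.1, Sum.inl b.2) : Idx (fine Lc M') (Fib d)))
        (Subtype.val : Res (toSite r') Lc M' → ↥(pbox M')))
    (hDbar : Dbar = Matrix.of fun (a : ↥(pbox M') × Fin (d + 1)) (t : Res (toSite r') Lc M') =>
        stepScale d Lc j * (((box (d + 1) Lc).card : ℝ) * tgrad M' (a.1, Sum.inl a.2) t.1))
    (hP : P = (combRowsT ((Lc : ℤ) • toSite r' + toSite r) (Lc * Lc) (fine Lc M')).submatrix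
        (resBigEquiv Lc Lc (toSite r) (toSite r') M' (Nat.pos_of_ne_zero (NeZero.ne Lc)) (toSite_mem_range hr)
          (Nat.pos_of_ne_zero (NeZero.ne Lc)) (toSite_mem_range hr')).symm
        (fun b : ↥(pbox (fine Lc M')) × Fin (d + 1) => ((b.1, Sum.inl b.2) : Idx (fine Lc M') (Fib d))))
    -- the displayed jets: form, averaging (both levels), block covariance, generators (fine and coarse), Ward witnesses
    (H₁ H₂ : Matrix (↥(pbox (fine Lc M')) × Fin (d + 1)) (↥(pbox (fine Lc M')) × Fin (d + 1)) ℝ)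
    {Q₂₀ : Matrix κ (↥(pbox M') × Fin (d + 1)) ℝ}
    (hQ₂₀ : Q₂₀ = (perF M' (bhKStepAt d (toSite r') Lc (j + 1))).submatrix (fun a : κ => ((pμ' a, Sum.inr (mμ' a)) : Idx M' (Fib d)))
        (fun b : ↥(pbox M') × Fin (d + 1) => ((b.1, Sum.inl b.2) : Idx M' (Fib d))))
    (Q₁₁ Q₁₂ : Matrix (↥(pbox M') × Fin (d + 1)) (↥(pbox (fine Lc M')) × Fin (d + 1)) ℝ) (Q₂₁ Q₂₂ : Matrix κ (↥(pbox M') × Fin (d + 1)) ℝ)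
    (W₁ W₂ : Matrix (↥(pbox (fine Lc M')) × Fin (d + 1)) (Res (toSite r') Lc M' ⊕ Res (toSite r) Lc (fine Lc M')) ℝ)
    (Db₁ Db₂ : Matrix (↥(pbox M') × Fin (d + 1)) (Res (toSite r') Lc M') ℝ)
    (Y₀ Y₁ Y₂ Y'₀ Y'₁ Y'₂ : Matrix κ (Res (toSite r') Lc M' ⊕ Res (toSite r) Lc (fine Lc M')) ℝ)
    {𝔔₀ 𝔔₁ 𝔔₂ : Matrix κ (↥(pbox (fine Lc M')) × Fin (d + 1)) ℝ}
    (h𝔔₀ : Q₂₀ * Q₁₀ = 𝔔₀) (h𝔔₁ : Q₂₁ * Q₁₀ + Q₂₀ * Q₁₁ = 𝔔₁) (h𝔔₂ : Q₂₂ * Q₁₀ + Q₂₁ * Q₁₁ + (Q₂₁ * Q₁₁ + Q₂₀ * Q₁₂) = 𝔔₂)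
    -- the second-order composite Ward TABLE IDENTITIES (δ-constrained: `𝔎 = H`; p308750's moving shapes, `W₀ := [D₂ | D₁]`) and their transposes
    (a0 : H₀ * fromCols D₂ D₁ = 𝔔₀ᵀ * Y₀) (a1 : H₁ * fromCols D₂ D₁ + H₀ * W₁ = 𝔔₁ᵀ * Y₀ + 𝔔₀ᵀ * Y₁)
    (a2 : H₂ * fromCols D₂ D₁ + (2 : ℝ) • (H₁ * W₁) + H₀ * W₂ = 𝔔₂ᵀ * Y₀ + (2 : ℝ) • (𝔔₁ᵀ * Y₁) + 𝔔₀ᵀ * Y₂)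
    (a0t : H₀ᵀ * fromCols D₂ D₁ = 𝔔₀ᵀ * Y'₀) (a1t : H₁ᵀ * fromCols D₂ D₁ + H₀ᵀ * W₁ = 𝔔₁ᵀ * Y'₀ + 𝔔₀ᵀ * Y'₁)
    (a2t : H₂ᵀ * fromCols D₂ D₁ + (2 : ℝ) • (H₁ᵀ * W₁) + H₀ᵀ * W₂ = 𝔔₂ᵀ * Y'₀ + (2 : ℝ) • (𝔔₁ᵀ * Y'₁) + 𝔔₀ᵀ * Y'₂)
    -- the insertion-table covariance TABLE IDENTITIES (orders 1, 2; leaf-02's jet shapes) and the coarse covariance identities (order 0 discharged)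
    (c1 : Q₁₁ * fromCols D₂ D₁ + Q₁₀ * W₁ = fromCols Db₁ 0) (c2 : Q₁₂ * fromCols D₂ D₁ + (2 : ℝ) • (Q₁₁ * W₁) + Q₁₀ * W₂ = fromCols Db₂ 0)
    (d1 : Q₂₁ * Dbar + Q₂₀ * Db₁ = 0) (d2 : Q₂₂ * Dbar + (2 : ℝ) • (Q₂₁ * Db₁) + Q₂₀ * Db₂ = 0)
    -- block namings and the coarse non-degeneracy
    {Γ : Matrix (↥(pbox (fine Lc M')) × Fin (d + 1)) (↥(pbox (fine Lc M')) × Fin (d + 1)) ℝ}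
    {I : Matrix (↥(pbox (fine Lc M')) × Fin (d + 1)) ((↥(pbox M') × Fin (d + 1)) ⊕ Res (toSite r) Lc (fine Lc M')) ℝ}
    {L : Matrix ((↥(pbox M') × Fin (d + 1)) ⊕ Res (toSite r) Lc (fine Lc M')) (↥(pbox (fine Lc M')) × Fin (d + 1)) ℝ}
    {S : Matrix ((↥(pbox M') × Fin (d + 1)) ⊕ Res (toSite r) Lc (fine Lc M')) ((↥(pbox M') × Fin (d + 1)) ⊕ Res (toSite r) Lc (fine Lc M')) ℝ}
    {B : Matrix ((↥(pbox M') × Fin (d + 1)) ⊕ Res (toSite r) Lc (fine Lc M')) (↥(pbox (fine Lc M')) × Fin (d + 1)) ℝ}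
    (hΓ : flucCov H₀ (fromRows Q₁₀ τ₁) = Γ) (hI : minOp H₀ (fromRows Q₁₀ τ₁) = I) (hL : minOpL H₀ (fromRows Q₁₀ τ₁) = L) (hS : effForm H₀ (fromRows Q₁₀ τ₁) = S)
    (hB : fromRows Q₁₁ (0 : Matrix (Res (toSite r) Lc (fine Lc M')) (↥(pbox (fine Lc M')) × Fin (d + 1)) ℝ) = B) :
    secondVar (kkt H₀ (fromRows 𝔔₀ P))
        (kkt H₁ (fromRows 𝔔₁ (0 : Matrix (Res (toSite r') Lc M' ⊕ Res (toSite r) Lc (fine Lc M')) (↥(pbox (fine Lc M')) × Fin (d + 1)) ℝ)))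
        (kkt H₂ (fromRows 𝔔₂ (0 : Matrix (Res (toSite r') Lc M' ⊕ Res (toSite r) Lc (fine Lc M')) (↥(pbox (fine Lc M')) × Fin (d + 1)) ℝ)))
      = secondVar (kkt H₀ (fromRows Q₁₀ τ₁)) (kkt H₁ B)
            (kkt H₂ (fromRows Q₁₂ (0 : Matrix (Res (toSite r) Lc (fine Lc M')) (↥(pbox (fine Lc M')) × Fin (d + 1)) ℝ)))
        + secondVar
            (kkt S.toBlocks₁₁ (fromRows Q₂₀ τ₂))
            (kkt ((L * H₁ - S * B) * I - L * Bᵀ * S).toBlocks₁₁ (fromRows Q₂₁ (0 : Matrix (Res (toSite r') Lc M') (↥(pbox M') × Fin (d + 1)) ℝ)))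
            (kkt (((-((L * H₁ - S * B) * Γ + L * Bᵀ * L) * H₁ + L * H₂
                      - (((L * H₁ - S * B) * I - L * Bᵀ * S) * B
                          + S * fromRows Q₁₂ (0 : Matrix (Res (toSite r) Lc (fine Lc M')) (↥(pbox (fine Lc M')) × Fin (d + 1)) ℝ))) * I
                    + (L * H₁ - S * B) * (-((Γ * H₁ + I * B) * I - Γ * Bᵀ * S)))
                  - ((-((L * H₁ - S * B) * Γ + L * Bᵀ * L) * Bᵀ
                        + L * (fromRows Q₁₂ (0 : Matrix (Res (toSite r) Lc (fine Lc M')) (↥(pbox (fine Lc M')) × Fin (d + 1)) ℝ))ᵀ) * S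
                      + L * Bᵀ * ((L * H₁ - S * B) * I - L * Bᵀ * S))).toBlocks₁₁
              (fromRows Q₂₂ (0 : Matrix (Res (toSite r') Lc M') (↥(pbox M') × Fin (d + 1)) ℝ)))
        + (2 * secondVar (P * fromCols D₂ D₁) (P * W₁) (P * W₂)
          - 2 * secondVar (fromRows (τ₂ * Q₁₀) τ₁ * fromCols D₂ D₁)
              (fromRows (τ₂ * Q₁₁) (0 : Matrix (Res (toSite r) Lc (fine Lc M')) (↥(pbox (fine Lc M')) × Fin (d + 1)) ℝ) * fromCols D₂ D₁
                + fromRows (τ₂ * Q₁₀) τ₁ * W₁)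
              (fromRows (τ₂ * Q₁₂) (0 : Matrix (Res (toSite r) Lc (fine Lc M')) (↥(pbox (fine Lc M')) × Fin (d + 1)) ℝ) * fromCols D₂ D₁
                + fromRows (τ₂ * Q₁₁) (0 : Matrix (Res (toSite r) Lc (fine Lc M')) (↥(pbox (fine Lc M')) × Fin (d + 1)) ℝ) * W₁
                + (fromRows (τ₂ * Q₁₁) (0 : Matrix (Res (toSite r) Lc (fine Lc M')) (↥(pbox (fine Lc M')) × Fin (d + 1)) ℝ) * W₁
                  + fromRows (τ₂ * Q₁₀) τ₁ * W₂))) := by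
  have d0 : Q₂₀ * Dbar = 0 := by rw [hQ₂₀, hDbar]; exact torus_cov₀' M' hr' hM' j (j + 1) pμ' mμ'
  have h := secondVar_oneShot_nestedStepLaw_torus M' hr hr' hM' j hH₀ hQ₁₀ hτ₁ hτ₂ hD₁ hD₂ hDbar hP H₁ H₂ Q₁₁ Q₁₂ Q₂₀ Q₂₁ Q₂₂ 0 0 0 W₁ W₂ Db₁ Db₂
    Y₀ Y₁ Y₂ Y'₀ Y'₁ Y'₂
    (show H₀ + Q₁₀ᵀ * (0 : Matrix (↥(pbox M') × Fin (d + 1)) (↥(pbox M') × Fin (d + 1)) ℝ) * Q₁₀ = H₀ by simp)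
    (show H₁ + (Q₁₁ᵀ * (0 : Matrix (↥(pbox M') × Fin (d + 1)) (↥(pbox M') × Fin (d + 1)) ℝ) * Q₁₀
        + Q₁₀ᵀ * (0 : Matrix (↥(pbox M') × Fin (d + 1)) (↥(pbox M') × Fin (d + 1)) ℝ) * Q₁₀
        + Q₁₀ᵀ * (0 : Matrix (↥(pbox M') × Fin (d + 1)) (↥(pbox M') × Fin (d + 1)) ℝ) * Q₁₁) = H₁ by simp)
    (show H₂ + ((Q₁₂ᵀ * (0 : Matrix (↥(pbox M') × Fin (d + 1)) (↥(pbox M') × Fin (d + 1)) ℝ) * Q₁₀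
          + Q₁₁ᵀ * (0 : Matrix (↥(pbox M') × Fin (d + 1)) (↥(pbox M') × Fin (d + 1)) ℝ) * Q₁₀
          + Q₁₁ᵀ * (0 : Matrix (↥(pbox M') × Fin (d + 1)) (↥(pbox M') × Fin (d + 1)) ℝ) * Q₁₁)
        + (Q₁₁ᵀ * (0 : Matrix (↥(pbox M') × Fin (d + 1)) (↥(pbox M') × Fin (d + 1)) ℝ) * Q₁₀
          + Q₁₀ᵀ * (0 : Matrix (↥(pbox M') × Fin (d + 1)) (↥(pbox M') × Fin (d + 1)) ℝ) * Q₁₀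
          + Q₁₀ᵀ * (0 : Matrix (↥(pbox M') × Fin (d + 1)) (↥(pbox M') × Fin (d + 1)) ℝ) * Q₁₁)
        + (Q₁₁ᵀ * (0 : Matrix (↥(pbox M') × Fin (d + 1)) (↥(pbox M') × Fin (d + 1)) ℝ) * Q₁₁
          + Q₁₀ᵀ * (0 : Matrix (↥(pbox M') × Fin (d + 1)) (↥(pbox M') × Fin (d + 1)) ℝ) * Q₁₁
          + Q₁₀ᵀ * (0 : Matrix (↥(pbox M') × Fin (d + 1)) (↥(pbox M') × Fin (d + 1)) ℝ) * Q₁₂)) = H₂ by simp)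
    h𝔔₀ h𝔔₁ h𝔔₂ a0 a1 a2 a0t a1t a2t c1 c2 d0 d1 d2 hΓ hI hL hS hB
    (by
      rw [add_zero, ← hS, hH₀, hQ₁₀, hτ₁, hQ₂₀, hτ₂]
      exact torus_h2_record M' hr j hr' hM' (coarsePt M' Lc) (coarsePt_coe M' Lc) (coarseSlot_injective M') (coarseSlot_range M')
        (fun a : κ => ((pμ' a, Sum.inr (mμ' a)) : Idx M' (Fib d))) hfμ' (fun a => ⟨mμ' a, rfl⟩) hcoarse')
  simpa only [add_zero] using h

end Delta

end Summit.QuantumFields.BalabanUV.Beta.FP.NestedStepLawTorusInstanceDelta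

end
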